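import Literature.AlgebraicGeometry.AbelianSchemes.CechH1CountOfFlatPoincareData
import Literature.AlgebraicGeometry.Motives.AbelianVarietyProjectiveChart
import Literature.AlgebraicGeometry.Morphisms.ProjectiveMorphismComposition
import Literature.AlgebraicGeometry.Morphisms.FinsetInAffineOpenOfProjective
import Literature.AlgebraicGeometry.GroupSchemes.GroupLawDescendsAlongTorsorQuotient
import Literature.AlgebraicGeometry.RelativeSpec.TorsorQuotientDescent
import Literature.AlgebraicGeometry.RelativeSpec.TorsorQuotientGlobal
import Literature.AlgebraicGeometry.GroupSchemes.TorsorQuotientKernelOnPoints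
import Literature.AlgebraicGeometry.AbelianSchemes.AbelianSchemeOfFlatSurjectiveImage
import Literature.AlgebraicGeometry.GroupSchemes.TranslationActionFree
import Literature.AlgebraicGeometry.GroupSchemes.FiniteFlatGroupSchemeFreeHopf
import Literature.AlgebraicGeometry.GroupSchemes.GroupSchemeActionOrbitSaturation
import Literature.AlgebraicGeometry.GroupSchemes.GroupSchemeActionChartFree
import Literature.AlgebraicGeometry.GroupSchemes.GroupSchemeActionInvariantSubobject
import Literature.AlgebraicGeometry.GroupSchemes.GroupSchemeActionProperFree
import Literature.AlgebraicGeometry.GroupSchemes.AffineGroupSchemeOfHopfAlgebra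
import Literature.AlgebraicGeometry.GroupSchemes.AffineGroupSchemeActionCoaction
import Literature.AlgebraicGeometry.GroupSchemes.FiniteFlatGroupSchemeQuotientAffineChart
import Literature.AlgebraicGeometry.AbelianSchemes.AbelianSchemeOverHomNoetherian
import Literature.AlgebraicGeometry.AbelianSchemes.AbelianSchemeLocalRelDim
import Mathlib.AlgebraicGeometry.Morphisms.QuasiFinite
import Mathlib.CategoryTheory.Monoidal.Mod
import Literature.AlgebraicGeometry.RelativeSpec.TorsorQuotientGluing
import Literature.AlgebraicGeometry.AbelianSchemes.MumfordPoincareOfFiniteFlatKernel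
import HarnessLib

/-!
# `dim_k Ȟ¹(𝔘, 𝒪_B) = dim B` for EVERY abelian variety over EVERY field, UNCONDITIONALLY — via the dual `A⁄K(L)` by the FINITE FLAT group scheme `K(L)`
# ([MumfordAV1970] §12 Thm. 1, §13 Theorem, §13 Cor. 2; [SGA3I] Exp. V Thm. 4.1)

Layer `Literature/AlgebraicGeometry/AbelianSchemes`, namespaces `Literature.AlgebraicGeometry.AbelianSchemes.AbelianSchemeOver` (§1) and
`Literature.AlgebraicGeometry.AbelianSchemes.MumfordDual` (§2–§3).  THEOREMS ONLY (no definition, no named fact, no instance, no notation, no `sorry`).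

★ `CechH1CountOfFlatPoincareData` reduces [MumfordAV1970] §13 Cor. 2 in every characteristic to its one printed input, the binder `hMD` «every abelian
scheme of relative dimension `g` over every ALGEBRAICALLY CLOSED field carries FLAT POINCARÉ DATA `(L, Â, π, 𝒫)`»: `L` rank one rigidified along the unit
section, `π : A → Â` a flat surjective homomorphism onto an abelian scheme of relative dimension `g` with kernel `K(L)` on points, `𝒫` rank one on `A × Â`
with `(1 × π)^*𝒫 ≅ Λ(L)` and every slice `𝒫|_{A × {b}}` in `Pic⁰`.  This file DISCHARGES `hMD` and states the count unconditionally: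

* §1 `AbelianSchemeOver.exists_quotient_of_finiteFlat_closedSubgroup` — **quotient of an abelian scheme by a finite flat closed subgroup scheme** over a
  Noetherian LOCAL affine base `Spec R` ([MumfordAV1970] §12 Thm. 1 (p. 111) over a field; [SGA3I] Exp. V Thm. 4.1 ∕ [GortzWedhorn2023] Thm. 27.68 +
  Prop. 27.62 + Cor. 27.177 (1) over a base): for `A` an abelian scheme whose finite sets of points lie in affine opens (kept as a binder; automatic over
  a field or an Artin local ring) and `i : Z ↪ A` a closed immersion with `Z → Spec R` finite flat through which unit, product and inverse factor, there
  is an abelian scheme `Â` and a finite flat surjective homomorphism `π : A → Â` with kernel `Z` on `T`-valued points, `Â` of relative dimension `g` when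
  `A` is.  PROOF = assembly of ★ organs, no new idea: free translation action with closed graph (★ `TranslationAction.*`), `Z` affine with finite free
  coordinate ring over the local base (★ `AffineGroupScheme.isAffine_and_moduleFinite_and_moduleFree`), `Z`-stable affine charts (★
  `ActionOrbit.forall_exists_stable_isAffineOpen_of_free` — SGA 3 V 4.1 (b)), chart quotients by the finite locally free Hopf coaction (★
  `FiniteFlatQuotientAffine.Chart.exists_chart`), gluing (★ `RelativeSpec.TorsorQuotient.exists_chartedQuotientDatum`, ★ `RelativeSpec.TorsorQuotientGlobal.*`),
  descent of the group law (★ `GroupSchemes.TorsorQuotient.exists_grpObj_isMonHom_of_isPullback`), kernel on points (★ `GroupSchemes.TorsorQuotientKernel.Over.comp_eq_one_iff`),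
  and the target is abelian of the same relative dimension (★ `AbelianSchemeOfFlatSurjectiveImage`).
* §2 `MumfordDual.forall_flatPoincareData` — **flat Poincaré data exist** over every algebraically closed field ([MumfordAV1970] §13 Theorem (p. 125) with
  `Â := A⁄K(L)`): ★ `exists_rankOne_kOfL_closedSubgroup` (the rigidified `L = 𝒪(Θ)` of ample geometric class and its FINITE closed subgroup scheme
  `K(L)`, flat over the one-point base), §1 (the affine-opens binder from projectivity: ★ `AbelianVariety.isProjectiveOver_holds`, ★
  `Morphisms.exists_isAffineOpen_forall_mem_of_isProjective`), ★ `exists_poincare_of_finiteFlatKernel` (descent of `Λ(L)` to `𝒫`, slices in `Pic⁰`).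
  Stated in the ∀-form, binder for binder the hypothesis `hMD`.
* §3 `MumfordDual.finite_finrank_cechH1_eq_dim` — for every abelian scheme `B` over every field `k` (any characteristic) and every finite affine open cover
  `𝔘`, `Ȟ¹(𝔘, 𝒪_B)` is a finite `k`-module of rank `dim B` ([MumfordAV1970] §13 Cor. 2 (p. 129)) := ★ `finite_finrank_cechH1_eq_dim_of_forall_flatPoincareData` at §2;
  `MumfordDual.hH1_holds` — the H¹-COUNT LETTER `dim B ≤ dim_k Ȟ¹(𝔘, 𝒪_B) + 1`, ∀-form, binder for binder the hypothesis `hH1` of ★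
  `AbelianSchemeOver.exists_abelianLift_of_isUnit_two` ([Oort1971] Thm. (2.2.1) at `2 ∈ A^×`), which thereby becomes unconditional.

Provenance: §1 and §2 were first kernel-checked as the §Q junction and the glue `forall_flatPoincareData_of_stubs` of the crux workfile
`Summits/HodgeConjecture/HodgeConjecture/Cruxes/HLiu418/Lines/F0_P6b_MumfordDualFlat.lean` (ED. 3∕4, cell hodgecm-mathlib, desk F0P6b-plan); they are re-homed here (proof of §1
VERBATIM, binders Mathlib-ised) so that the quotient theorem and the count are importable Literature capital.  Earlier ★ editions of the count:
characteristic `0` (★ `AbelianVarieties.finrank_cechH1_structureSheaf_eq_dim_of_charZero`), separably polarised `B` (★ `CechH1CountOfPoincareDataHead`),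
conditional on `hMD` (★ `CechH1CountOfFlatPoincareData`).  NOT here: the quotient over a non-local or non-affine base; residue characteristic `2` lifting.

## References
* [MumfordAV1970] D. Mumford, *Abelian Varieties* (1970), §12 Thm. 1 (p. 111); §13 (p. 123), Theorem (p. 125), its proof (pp. 125–129) and Cor. 2 (p. 129).
* [SGA3I] M. Demazure, A. Grothendieck, *Schémas en groupes I* (SGA 3, Tome I), LNM 151 (1970), Exp. V (P. Gabriel) Thm. 4.1.
* [GortzWedhorn2023] U. Görtz, T. Wedhorn, *Algebraic Geometry II* (2023), Thm. 27.68, Prop. 27.62 and Cor. 27.177 (1).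
* [StacksProject] The Stacks Project, Tag 02KH (flat base change of Čech cohomology).
* [Oort1971] F. Oort, *Finite group schemes, local moduli for abelian varieties, and lifting problems*, Compositio Math. 23 (1971), Thm. (2.2.1) (p. 273).
-/

set_option autoImplicit false

noncomputable section

-- cartesian-monoidal `Over (Spec R)` products ∕ `Mod_Class` translation action `γ[Z, A]` vs `(i ▷ A) ≫ μ` agree only at default
-- transparency (as in the ★ organs `TranslationActionFree`, `GroupSchemeActionChartFree` §1 assembles, and in ★ `CechH1CountOfFlatPoincareData`).
set_option backward.isDefEq.respectTransparency false

open CategoryTheory CategoryTheory.Limits AlgebraicGeometry MonoidalCategory CartesianMonoidalCategory IsLocalRing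
open scoped MonObj

namespace Literature.AlgebraicGeometry.AbelianSchemes

open Literature.AlgebraicGeometry.Motives Literature.AlgebraicGeometry.AbelianVarieties Literature.AlgebraicGeometry.Modules
open Literature.AlgebraicGeometry
open Literature.AlgebraicGeometry.Morphisms (CechH1)

/-! ## §1 Quotient of an abelian scheme by a finite flat closed subgroup scheme ([MumfordAV1970] §12 Thm. 1, [SGA3I] Exp. V Thm. 4.1) -/

/-- **Quotient of an abelian scheme by a finite flat closed subgroup scheme** ([MumfordAV1970] §12 Thm. 1 over a field; [SGA3I] Exp. V
Thm. 4.1, [GortzWedhorn2023] Thm. 27.68 + Prop. 27.62 + Cor. 27.177 (1) over a base).  Over a Noetherian local affine base `Spec R`, let `A` be an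
abelian scheme whose finite sets of points lie in affine opens, and `i : Z ↪ A` a closed immersion over `Spec R` with `Z → Spec R` finite and
flat, through which the unit `η`, the product `(pr₁ ≫ i) * (pr₂ ≫ i)` and the inverse `i⁻¹` factor.  Then there is an abelian scheme `Â` over
`Spec R` and a homomorphism `π : A → Â`, finite, flat and surjective, with `u ≫ π = 1 ↔ ∃ v, v ≫ i = u` for every `T`-valued point `u` of `A`,
and `Â` is of relative dimension `g` whenever `A` is.
[cite: MumfordAV1970, §12 Thm. 1 (p. 111)] -/
theorem AbelianSchemeOver.exists_quotient_of_finiteFlat_closedSubgroup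
    {R : Type} [CommRing R] [IsNoetherianRing R] [IsLocalRing R] (A : AbelianSchemeOver (Spec (.of R)))
    (hcov : ∀ F : Finset A.X.left, ∃ U : A.X.left.Opens, IsAffineOpen U ∧ ∀ x ∈ F, x ∈ U)
    (Z : Over (Spec (.of R))) (i : Z ⟶ A.X) [IsClosedImmersion i.left] [IsFinite Z.hom] [Flat Z.hom]
    (he : ∃ e : 𝟙_ (Over (Spec (.of R))) ⟶ Z, e ≫ i = 1)
    (hm : ∃ m : Z ⊗ Z ⟶ Z, m ≫ i = (fst Z Z ≫ i) * (snd Z Z ≫ i))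
    (hn : ∃ n : Z ⟶ Z, n ≫ i = i⁻¹) :
    ∃ (hat : AbelianSchemeOver (Spec (.of R))) (π : A.X ⟶ hat.X) (_ : IsMonHom π) (_ : IsFinite π.left) (_ : Flat π.left)
      (_ : Surjective π.left),
      (∀ (T : Over (Spec (.of R))) (u : T ⟶ A.X), u ≫ π = 1 ↔ ∃ v : T ⟶ Z, v ≫ i = u) ∧
      ∀ g : ℕ, A.IsOfRelDim g → hat.IsOfRelDim g := by
  open Literature.AlgebraicGeometry.GroupSchemes Literature.AlgebraicGeometry.GroupSchemes.AffineGroupScheme in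
  -- the subgroup scheme structure on `Z` making `i` a homomorphism
  obtain ⟨GZ, hi⟩ := TorsorQuotientKernel.Over.exists_grpObj_isMonHom_of_factors i he hm hn
  letI := GZ
  haveI := hi
  haveI : ConnectedSpace ↥(Spec (.of R)) := Morphisms.connectedSpace_Spec_of_isLocalRing R
  haveI : IsCommMonObj A.X := A.isCommMonObj_of_isLocallyNoetherian
  haveI : Mono i := TorsorQuotientKernel.Over.mono_of_isClosedImmersion_left i
  haveI : IsCommMonObj Z := TorsorQuotientKernel.isCommMonObj_of_mono i
  -- the translation action of `Z` on `A`: free, with closed graph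
  letI σ : ModObj Z A.X := letI : ModObj A.X A.X := ModObj.regular A.X; Mod.scalarRestriction i A.X
  have hγ : γ[Z, A.X] = (i ▷ A.X) ≫ μ[A.X] := rfl
  have hfreeA : IsFreeAction Z A.X := TranslationAction.isFreeAction_of_isClosedImmersion_left i hγ
  have hci2 : IsClosedImmersion (lift ((i ▷ A.X) ≫ μ[A.X]) (snd Z A.X)).left :=
    TranslationAction.isClosedImmersion_lift_act_snd_left i
  -- `Z` is affine with finite free coordinate ring over the local base
  obtain ⟨hZaff, hZmf, hZfree⟩ := AffineGroupScheme.isAffine_and_moduleFinite_and_moduleFree Z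
  haveI := hZaff
  haveI := hZmf
  haveI := hZfree
  haveI := A.isProper
  haveI : A.X.left.IsSeparated := by
    have h1 : IsSeparated A.X.hom := A.isProper.toIsSeparated
    have h2 : IsSeparated (terminal.from (Spec (.of R))) := inferInstance
    refine ⟨?_⟩
    rw [show terminal.from A.X.left = A.X.hom ≫ terminal.from _ from terminal.hom_ext _ _]
    exact MorphismProperty.comp_mem _ _ _ h1 h2
  -- `Z`-stable affine charts (SGA 3 V 4.1 (b))
  have hcov' : ∀ x : ↥A.X.left, ∃ U : A.X.left.Opens, x ∈ U ∧ IsAffineOpen U ∧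
      Set.range ((Z ◁ (Over.homMk U.ι : Over.mk (U.ι ≫ A.X.hom) ⟶ A.X)) ≫ γ[Z, A.X]).left ⊆ (U : Set ↥A.X.left) :=
    fun x => ActionOrbit.forall_exists_stable_isAffineOpen_of_free hcov x
  -- the affine quotient on each stable chart
  have hchart' : ∀ (U : A.X.left.Opens), IsAffineOpen U →
      ∀ (a : Z ⊗ Over.mk (U.ι ≫ A.X.hom) ⟶ Over.mk (U.ι ≫ A.X.hom)),
        a ≫ (Over.homMk U.ι : Over.mk (U.ι ≫ A.X.hom) ⟶ A.X) =
          (Z ◁ (Over.homMk U.ι : Over.mk (U.ι ≫ A.X.hom) ⟶ A.X)) ≫ γ[Z, A.X] →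
      ∃ (QU : Over (Spec (.of R))) (q : Over.mk (U.ι ≫ A.X.hom) ⟶ QU),
        IsAffine QU.left ∧ LocallyOfFiniteType QU.hom ∧ IsFinite q.left ∧ Flat q.left ∧ Surjective q.left ∧
        a ≫ q = snd Z (Over.mk (U.ι ≫ A.X.hom)) ≫ q ∧
        IsPullback a.left (snd Z (Over.mk (U.ι ≫ A.X.hom))).left q.left q.left := by
    intro U hU a ha
    have hjU : Mono (Over.homMk U.ι rfl : Over.mk (U.ι ≫ A.X.hom) ⟶ A.X).left := (inferInstance : Mono U.ι)
    haveI : Mono (Over.homMk U.ι rfl : Over.mk (U.ι ≫ A.X.hom) ⟶ A.X) := Over.mono_of_mono_left _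
    letI σU : ModObj Z (Over.mk (U.ι ≫ A.X.hom)) :=
      ActionRestrict.actionObj (Over.homMk U.ι rfl : Over.mk (U.ι ≫ A.X.hom) ⟶ A.X) a ha
    have hfreeU : IsFreeAction Z (Over.mk (U.ι ≫ A.X.hom)) :=
      IsFreeAction.restrict (Over.homMk U.ι rfl : Over.mk (U.ι ≫ A.X.hom) ⟶ A.X) a ha hfreeA
    haveI : IsAffine (Over.mk (U.ι ≫ A.X.hom)).left := hU
    haveI : LocallyOfFiniteType (Over.mk (U.ι ≫ A.X.hom)).hom := by
      change LocallyOfFiniteType (U.ι ≫ A.X.hom); infer_instance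
    haveI : Algebra.FiniteType R (Alg (Over.mk (U.ι ≫ A.X.hom))) := AffineGroupScheme.Alg.finiteType _
    exact FiniteFlatQuotientAffine.Chart.exists_chart (AffineGroupScheme.coaction Z (Over.mk (U.ι ≫ A.X.hom)))
      (AffineGroupScheme.lift_comap_comp_coaction Z _) (AffineGroupScheme.coaction_coassoc Z _)
      (AffineGroupScheme.coaction_counit Z _) (AffineGroupScheme.surjective_productMap_coaction Z _ hfreeU)
  -- glue the charts
  obtain ⟨Q, π, J, U, a, QU, q, ιQ, hw, hopen, hQcov, hch⟩ :=
    RelativeSpec.TorsorQuotient.exists_chartedQuotientDatum hcov' hchart'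
  have hsq : IsPullback γ[Z, A.X] (snd Z A.X) π π :=
    RelativeSpec.TorsorQuotientGlobal.isPullback_act_snd_of_chartedQuotient γ[Z, A.X] π hw U a QU q ιQ hopen hQcov hch
  haveI hfin : IsFinite π.left := RelativeSpec.TorsorQuotientGlobal.isFinite_of_chartedQuotient γ[Z, A.X] π U a QU q ιQ hopen hQcov hch
  haveI hfl : Flat π.left := RelativeSpec.TorsorQuotientGlobal.flat_of_chartedQuotient γ[Z, A.X] π U a QU q ιQ hopen hQcov hch
  haveI hsurj : Surjective π.left :=
    RelativeSpec.TorsorQuotientGlobal.surjective_of_chartedQuotient γ[Z, A.X] π U a QU q ιQ hopen hQcov hch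
  haveI hlft : LocallyOfFiniteType Q.hom :=
    RelativeSpec.TorsorQuotientGlobal.locallyOfFiniteType_of_chartedQuotient γ[Z, A.X] π U a QU q ιQ hopen hQcov hch
  haveI hsep : IsSeparated Q.hom :=
    RelativeSpec.TorsorQuotientGlobal.isSeparated_of_chartedQuotient γ[Z, A.X] π hw U a QU q ιQ hopen hQcov hch hci2
  haveI : QuasiCompact π.left := inferInstance
  -- the group law descends, and the kernel on points is `Z`
  obtain ⟨GQ, hπ, -⟩ := GroupSchemes.TorsorQuotient.exists_grpObj_isMonHom_of_isPullback i π hsq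
  letI := GQ
  haveI := hπ
  have hker : ∀ (T : Over (Spec (.of R))) (u : T ⟶ A.X), u ≫ π = 1 ↔ ∃ v : T ⟶ Z, v ≫ i = u :=
    GroupSchemes.TorsorQuotientKernel.Over.comp_eq_one_iff i π hsq
  -- the target is an abelian scheme of the same relative dimension
  have hsm : Smooth Q.hom := smooth_hom_of_isFinite_flat_surjective A π
  refine ⟨{ X := Q, isProper := isProper_hom_of_surjective A π, isSmooth := hsm,
            geometricallyConnected := geometricallyConnected_hom_of_surjective A π }, π, hπ, hfin, hfl, hsurj, hker,
    fun g hA => ?_⟩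
  exact (AbelianSchemeOver.isOfRelDim_iff _ g).mpr (smoothOfRelativeDimension_hom_of_isFinite_surjective A π hsm hA)


/-! ## §2 Flat Poincaré data over an algebraically closed field ([MumfordAV1970] §13 Theorem with `Â := A⁄K(L)`) -/

namespace MumfordDual

/-- **Flat Poincaré data exist** ([MumfordAV1970] §13 Theorem (p. 125), with the dual `Â := A⁄K(L)` of §12 Thm. 1 (p. 111)).  For every abelian scheme
`A` of relative dimension `g` over an algebraically closed field `K` there are: a rank-one `L` on `A` rigidified along the unit section; an abelian scheme
`Â` of relative dimension `g` and a flat surjective homomorphism `π : A → Â` whose kernel on `T`-valued points is `K(L)`; and a rank-one `𝒫` on `A × Â` with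
`(1 × π)^*𝒫 ≅ Λ(L)` (the Mumford bundle) and every slice `𝒫|_{A × {b}}` homogeneous (in `Pic⁰`).  ∀-form, VERBATIM the hypothesis `hMD` of ★
`MumfordDual.finite_finrank_cechH1_eq_dim_of_forall_flatPoincareData`.
[cite: MumfordAV1970, §13 Theorem (p. 125) and §12 Thm. 1 (p. 111)] -/
theorem forall_flatPoincareData :
    ∀ (K : Type) [Field K] [IsAlgClosed K] (A : AbelianSchemeOver (Spec (.of K))) (g : ℕ), A.IsOfRelDim g →
      ∃ (L : A.left.Modules) (hL : HasRank L 1) (_ : CechPic.pullback A.unitSection (detClass (HasRank.isFiniteLocallyFree' hL)) = 1)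
        (hat : AbelianSchemeOver (Spec (.of K))) (_ : hat.IsOfRelDim g) (π : A.X ⟶ hat.X) (_ : IsMonHom π) (_ : Flat π.left)
        (_ : Surjective π.left) (P : (A.prodLeft hat).Modules) (_ : HasRank P 1),
        (∀ (T : Over (Spec (.of K))) (u : T ⟶ A.X), u ≫ π = 1 ↔ A.MemKOfL L u) ∧
        (∀ b : Spec (.of K) ⟶ hat.X.left,
          IsHomogeneous (A.fibre (b ≫ hat.X.hom)).toAbelianVariety ((Scheme.Modules.pullback (A.fibreSlice hat b)).obj P)) ∧
        Nonempty ((Scheme.Modules.pullback (A.X ◁ π).left).obj P ≅ A.mumfordBundle L) := by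
  intro K _ _ A g hA
  -- the rigidified `L = 𝒪(Θ)` and its finite closed subgroup scheme `K(L)`
  obtain ⟨L, hL, hε, -, Z, i, hci, hZfin, hZ, he, hm, hn⟩ := A.exists_rankOne_kOfL_closedSubgroup K
  -- finite sets of points of the projective `A` lie in affine opens
  have hproj : Morphisms.IsProjective A.X.hom :=
    Morphisms.IsProjective.of_isProjectiveOver (AbelianVariety.isProjectiveOver_holds A.toAffine.toAbelianVariety)
  have hfin : ∀ F : Finset A.X.left, ∃ U : A.X.left.Opens, IsAffineOpen U ∧ ∀ x ∈ F, x ∈ U := fun F =>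
    Morphisms.exists_isAffineOpen_forall_mem_of_isProjective hproj F
  -- `K(L) → Spec K` is flat (one-point reduced base)
  haveI : Subsingleton ↥(Spec (CommRingCat.of K)) := inferInstanceAs (Subsingleton (PrimeSpectrum K))
  haveI := hci
  haveI := hZfin
  haveI : Flat Z.hom := inferInstance
  -- `Â := A⁄K(L)` (§1)
  obtain ⟨hat, π, hπmon, hπfin, hπflat, hπsurj, hker, hrd⟩ := A.exists_quotient_of_finiteFlat_closedSubgroup hfin Z i he hm hn
  have hker' : ∀ (T : Over (Spec (.of K))) (u : T ⟶ A.X), u ≫ π = 1 ↔ A.MemKOfL L u := fun T u => (hker T u).trans (hZ T u)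
  -- the descent of `Λ(L)` to `𝒫` ([MumfordAV1970] §13 Theorem)
  haveI := hπmon
  haveI := hπfin
  haveI := hπflat
  haveI := hπsurj
  obtain ⟨P, hP1, hpic, hsock⟩ := A.exists_poincare_of_finiteFlatKernel hat π hL hε hker'
  exact ⟨L, hL, hε, hat, hrd g hA, π, hπmon, hπflat, hπsurj, P, hP1, hker', hpic, hsock⟩

/-! ## §3 The count, unconditionally ([MumfordAV1970] §13 Cor. 2) -/

/-- **`dim_k Ȟ¹(𝔘, 𝒪_B) = dim B` for every abelian variety over every field** ([MumfordAV1970] §13 Cor. 2 (p. 129); any characteristic, `B` not assumed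
separably polarised): for every abelian scheme `B → Spec k` over a field `k` and every finite affine open cover `𝔘 = (V_j)` of `B`, the Čech cohomology
`Ȟ¹(𝔘, 𝒪_B)` is a finite `k`-module of rank `dim B` := ★ `finite_finrank_cechH1_eq_dim_of_forall_flatPoincareData` (descent from `k̄`, [StacksProject] Tag 02KH,
and the count from flat Poincaré data) at §2 `forall_flatPoincareData`.
[cite: MumfordAV1970, §13 Cor. 2 (p. 129)] -/
theorem finite_finrank_cechH1_eq_dim (k : Type) [Field k] (B : AbelianSchemeOver (Spec (.of k))) {I : Type} [Finite I]
    (V : I → B.X.left.Opens) (hV : ∀ j, IsAffineOpen (V j)) (hVcov : iSup V = ⊤) :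
    Module.Finite k (CechH1 B.X.hom V) ∧ Module.finrank k (CechH1 B.X.hom V) = B.toAffine.toAbelianVariety.dim :=
  finite_finrank_cechH1_eq_dim_of_forall_flatPoincareData forall_flatPoincareData k B V hV hVcov

/-- **THE H¹-COUNT LETTER, unconditionally**: `dim B ≤ dim_k Ȟ¹(𝔘, 𝒪_B) + 1` for every abelian scheme `B` over every field `k` and every finite affine
open cover `𝔘` — binder for binder the hypothesis `hH1` of ★ `AbelianSchemeOver.exists_abelianLift_of_isUnit_two` ([Oort1971] Thm. (2.2.1) at `2 ∈ A^×`)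
and of the junction `stub_L4B1u_of_cechH1Count` of the crux workfile `Cruxes/HLiu418/Lines/F0_P6b_BTSerreTate.lean`; `finite_finrank_cechH1_eq_dim` gives equality
:= ★ `hH1_of_forall_flatPoincareData` at §2.
[cite: MumfordAV1970, §13 Cor. 2 (p. 129)] -/
theorem hH1_holds :
    ∀ (k : Type) [Field k] (B : AbelianSchemeOver (Spec (.of k))) {I : Type} [Finite I] (V : I → B.X.left.Opens),
      (∀ j, IsAffineOpen (V j)) → iSup V = ⊤ → B.toAffine.toAbelianVariety.dim ≤ Module.finrank k (CechH1 B.X.hom V) + 1 :=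
  hH1_of_forall_flatPoincareData forall_flatPoincareData

end MumfordDual

end Literature.AlgebraicGeometry.AbelianSchemes

end
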